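import Mathlib
import HarnessLib
import Literature.MathematicalPhysics.QuantumLattice.FinDimSpectrumProofs
import Literature.MathematicalPhysics.QuantumLattice.GroundStateSourceBounds
import Literature.MathematicalPhysics.QuantumLattice.TraceInequalitiesProofs

/-!
# Crux `CwChiralConstruction` (stmt-HubbardSuperconductivity-1740), line `susceptibility-rise-budget`:
# stub `stub_slopeOfEnergyBounds`

The local Hellmann–Feynman slope estimate WITHOUT analytic perturbation theory: granted the two-sided
second-order energy bounds (hypothesis `(A)`, literally the statement of the neighbour stub
`stub_secondOrderEnergyBounds`: a Hermitian reduced resolvent `R` with `0 ≤ ω(XᴴRX) ≤ (ω(XᴴX) - |ωX|²)/g`,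
`ω(XᴴR²X) ≤ ω(XᴴRX)/g` and the two bounds for `E₀(K - B)`), for Hermitian `K, O, Y` with
`K.HasSpectralGap γ` and `ε > 0`: `|Re ω_{K-τY}(O) - Re ω_K(O)| ≤ (2√(Var O · Var Y)/γ + ε)|τ|` for small
`τ`. Proof (namespace `CwSlope`, finite-dimensional inequality bookkeeping): supergradient sandwich
`λ Re ω_A(O) ≤ E₀(A) - E₀(A - λO)` at `A = K - τY` (tree `GroundStateSourceBounds`; Hermitian real
multiples from tree `TraceInequalitiesProofs.isHermitian_real_smul`), the upper bound at
`B = τY` and the lower one at `B = τY + λO`, the sesquilinear expansion of `ω(BRB)`, Cauchy–Schwarz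
`(Re ω(YRO))² ≤ ω(YRY)ω(ORO)` (discriminant), `γ ω(ORO) ≤ Var O`, and `λ = κ|τ|` with `κ ω(ORO) ≤ ε/2`
(all error terms are `O(|τ|²)`); the lower estimate is the upper one for `-O`. Folklore (Kato,
*Perturbation theory for linear operators*, §II.2); no definitions, no named facts.
-/

set_option linter.dupNamespace false -- the summit namespace repeats `HubbardSuperconductivity`

namespace Summit.HubbardSuperconductivity.HubbardSuperconductivity.Theorems

open Literature.MathematicalPhysics.QuantumLattice Matrix
open scoped Matrix.Norms.L2Operator ComplexOrder

namespace CwSlope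

/-! ### Real-arithmetic bookkeeping -/

/-- Processing of the upper energy bound: for `ρ ≥ 0`, `Q ≥ 0`, `|w| ≤ N`,
`E - (w + Q - Nρ)/(1 + ρ) ≤ E - w - Q + ρ(2N + Q)`. [folklore] -/
theorem upper_aux {E E₁ w Q N ρ : ℝ} (hρ : 0 ≤ ρ) (hQ : 0 ≤ Q) (hw : |w| ≤ N)
    (h : E₁ ≤ E - (w + Q - N * ρ) / (1 + ρ)) : E₁ ≤ E - w - Q + ρ * (2 * N + Q) := by
  have h1 : 0 < 1 + ρ := by linarith
  have hwN : w ≤ N := (le_abs_self w).trans hw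
  have hN : 0 ≤ N := (abs_nonneg w).trans hw
  have key : w + Q - ρ * (2 * N + Q) ≤ (w + Q - N * ρ) / (1 + ρ) := by
    rw [le_div_iff₀ h1]
    nlinarith [mul_nonneg hρ (sub_nonneg.2 hwN),
      mul_nonneg (mul_nonneg hρ hρ) (by linarith : (0 : ℝ) ≤ 2 * N + Q)]
  linarith

/-- Processing of the lower energy bound: for `Q ≥ 0`, `0 ≤ N`, `4N ≤ γ`,
`γ/(γ - 2N) · Q ≤ Q + 4NQ/γ`. [folklore] -/
theorem lower_aux {E E₂ w Q N γ : ℝ} (hγ : 0 < γ) (hQ : 0 ≤ Q) (hN : 0 ≤ N) (h4N : 4 * N ≤ γ)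
    (h : E - w - γ / (γ - 2 * N) * Q ≤ E₂) : E - w - Q - 4 * N * Q / γ ≤ E₂ := by
  have hd : 0 < γ - 2 * N := by linarith
  have hP : 4 * N * Q / γ ≤ Q := by
    rw [div_le_iff₀ hγ]
    nlinarith [mul_nonneg hN hQ]
  have hPγ : 4 * N * Q / γ * γ = 4 * N * Q := div_mul_cancel₀ _ hγ.ne'
  have key : γ / (γ - 2 * N) * Q ≤ Q + 4 * N * Q / γ := by
    rw [div_mul_eq_mul_div, div_le_iff₀ hd]
    nlinarith [mul_le_mul_of_nonneg_left hP hN]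
  linarith

/-- Final assembly of the slope estimate from the core inequality with `λ = κ a`, `a = |τ| ≤ 1`:
the main term `c₂ ≤ M a` and the error terms `≤ κ ε a²` give `d ≤ (M + ε) a`. [folklore] -/
theorem final_aux {a κ ε γ M c₂ Qo qY nY nO C d : ℝ} (ha : 0 < a) (ha1 : a ≤ 1) (hκ : 0 < κ)
    (hγ : 0 < γ) (hqY : 0 ≤ qY)
    (hmain : κ * a * d ≤ κ * a * c₂ + (κ * a) ^ 2 * Qo +
      a ^ 2 * qY / γ * (2 * (a * nY) + a ^ 2 * qY) + 4 * (a * nY + κ * a * nO) ^ 3 / γ ^ 2)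
    (hc₂ : c₂ ≤ M * a) (hκQ : κ * Qo ≤ ε / 2)
    (hC : C = qY / γ * (2 * nY + qY) + 4 * (nY + κ * nO) ^ 3 / γ ^ 2)
    (haC : a * C ≤ ε * κ / 2) : d ≤ (M + ε) * a := by
  subst hC
  have hκa : 0 < κ * a := mul_pos hκ ha
  have h1 : κ * a * c₂ ≤ κ * a * (M * a) := mul_le_mul_of_nonneg_left hc₂ hκa.le
  have h2 : κ * a ^ 2 * (κ * Qo) ≤ κ * a ^ 2 * (ε / 2) :=
    mul_le_mul_of_nonneg_left hκQ (by positivity)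
  have h3 : a ^ 2 * (a * (qY / γ * (2 * nY + qY) + 4 * (nY + κ * nO) ^ 3 / γ ^ 2)) ≤
      a ^ 2 * (ε * κ / 2) := mul_le_mul_of_nonneg_left haC (by positivity)
  have e1 : 4 * (a * nY + κ * a * nO) ^ 3 / γ ^ 2 = a ^ 3 * (4 * (nY + κ * nO) ^ 3 / γ ^ 2) := by
    ring
  have e2 : a ^ 2 * qY / γ * (2 * (a * nY) + a ^ 2 * qY) =
      a ^ 3 * (2 * nY * (qY / γ)) + a ^ 4 * (qY * (qY / γ)) := by ring
  have e3 : a * (qY / γ * (2 * nY + qY) + 4 * (nY + κ * nO) ^ 3 / γ ^ 2) =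
      a * (2 * nY * (qY / γ)) + a * (qY * (qY / γ)) + a * (4 * (nY + κ * nO) ^ 3 / γ ^ 2) := by
    ring
  have h5 : a ^ 4 * (qY * (qY / γ)) ≤ a ^ 3 * (qY * (qY / γ)) := by
    have hX : 0 ≤ qY * (qY / γ) := by positivity
    exact mul_le_mul_of_nonneg_right (pow_le_pow_of_le_one ha.le ha1 (by norm_num)) hX
  have h4 : κ * a * d ≤ κ * a * ((M + ε) * a) := by
    rw [e1, e2] at hmain
    rw [e3] at h3
    nlinarith [h1, h2, h3, h5, hmain]
  exact le_of_mul_le_mul_left h4 hκa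

variable {n : Type*} [Fintype n] [DecidableEq n]

omit [DecidableEq n] in
/-- Sesquilinear expansion of `Re ω((αP + βS) R (αP + βS))` for a linear functional `ω` and real
`α, β`. [folklore] -/
theorem re_quad_expand (ω : Matrix n n ℂ →ₗ[ℂ] ℂ) (P S R : Matrix n n ℂ) (α β : ℝ) :
    (ω (((α : ℂ) • P + (β : ℂ) • S) * R * ((α : ℂ) • P + (β : ℂ) • S))).re =
      α ^ 2 * (ω (P * R * P)).re + α * β * ((ω (P * R * S)).re + (ω (S * R * P)).re) +
        β ^ 2 * (ω (S * R * S)).re := by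
  simp only [add_mul, mul_add, smul_mul_assoc, mul_smul_comm, map_add, map_smul, smul_eq_mul,
    Complex.add_re, Complex.mul_re, Complex.ofReal_re, Complex.ofReal_im, zero_mul, sub_zero]
  ring

omit [DecidableEq n] in
/-- `Re ω((αP) R (αP)) = α² Re ω(PRP)` for real `α`. [folklore] -/
theorem re_smul_quad (ω : Matrix n n ℂ →ₗ[ℂ] ℂ) (P R : Matrix n n ℂ) (α : ℝ) :
    (ω ((α : ℂ) • P * R * ((α : ℂ) • P))).re = α ^ 2 * (ω (P * R * P)).re := by
  simp only [smul_mul_assoc, mul_smul_comm, map_smul, smul_eq_mul, Complex.mul_re,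
    Complex.ofReal_re, Complex.ofReal_im, zero_mul, sub_zero]
  ring

/-- Symmetry `Re ω(SRP) = Re ω(PRS)` for Hermitian `P, S, R` (`(PRS)ᴴ = SRP` and
`Re ω(Xᴴ) = Re ω(X)`). [folklore] -/
theorem re_gsf_rev {K P S R : Matrix n n ℂ} (hP : P.IsHermitian) (hS : S.IsHermitian)
    (hR : R.IsHermitian) :
    (K.groundStateFunctional (S * R * P)).re = (K.groundStateFunctional (P * R * S)).re := by
  have : S * R * P = (P * R * S)ᴴ := by
    rw [conjTranspose_mul, conjTranspose_mul, hP.eq, hS.eq, hR.eq, Matrix.mul_assoc]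
  rw [this, groundStateFunctional_conjTranspose_re]

/-- Cauchy–Schwarz for the positive form `X ↦ ω(XᴴRX)`: `(Re ω(YRO))² ≤ Re ω(YRY) · Re ω(ORO)`
(discriminant of `t ↦ Re ω((Y + tO) R (Y + tO)) ≥ 0`). [folklore] -/
theorem re_cross_sq_le {K O Y R : Matrix n n ℂ} (hO : O.IsHermitian) (hY : Y.IsHermitian)
    (hR : R.IsHermitian)
    (hpos : ∀ X : Matrix n n ℂ, 0 ≤ (K.groundStateFunctional (Xᴴ * R * X)).re) :
    (K.groundStateFunctional (Y * R * O)).re ^ 2 ≤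
      (K.groundStateFunctional (Y * R * Y)).re * (K.groundStateFunctional (O * R * O)).re := by
  have hquad : ∀ t : ℝ, 0 ≤ (K.groundStateFunctional (O * R * O)).re * (t * t) +
      2 * (K.groundStateFunctional (Y * R * O)).re * t +
        (K.groundStateFunctional (Y * R * Y)).re := by
    intro t
    have h := hpos (Y + (t : ℂ) • O)
    have hX : (Y + (t : ℂ) • O)ᴴ = Y + (t : ℂ) • O := (hY.add (isHermitian_real_smul hO t)).eq
    rw [hX] at h
    have e := re_quad_expand K.groundStateFunctional Y O R 1 t
    simp only [Complex.ofReal_one, one_smul, one_pow, one_mul] at e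
    rw [e, re_gsf_rev hY hO hR] at h
    nlinarith [h]
  have hd := discrim_le_zero hquad
  rw [discrim] at hd
  nlinarith [hd]


/-! ### The core inequality and the one-sided slope estimate -/

/-- **Core inequality** at fixed `τ` and `l > 0` with `4(|τ|‖Y‖ + l‖O‖) < γ`: writing `ω = ω_K`,
`c = Re ω(YRO)`, `Q_X = Re ω(XRX)`,
`l (Re ω_{K-τY}(O) - Re ω_K(O)) ≤ l(2τc) + l² Q_O + (τ²Q_Y/γ)(2|τ|‖Y‖ + τ²Q_Y) + 4(|τ|‖Y‖ + l‖O‖)³/γ²`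
(sandwich `l Re ω_{K-τY}(O) ≤ E₀(K - τY) - E₀(K - τY - lO)`, upper energy bound at `B = τY`, lower
one at `B = τY + lO`, `ω(BR²B) ≤ Q_B/γ`, `Q_B ≤ ‖B‖²/γ`). [folklore] -/
theorem core [Nonempty n] {K O Y R : Matrix n n ℂ} (hK : K.IsHermitian) (hO : O.IsHermitian)
    (hY : Y.IsHermitian) (hR : R.IsHermitian) {γ : ℝ} (hγ : 0 < γ)
    (h1 : ∀ X : Matrix n n ℂ, 0 ≤ (K.groundStateFunctional (Xᴴ * R * X)).re)
    (h2 : ∀ X : Matrix n n ℂ, (K.groundStateFunctional (Xᴴ * R * X)).re ≤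
      ((K.groundStateFunctional (Xᴴ * X)).re - ‖K.groundStateFunctional X‖ ^ 2) / γ)
    (h3 : ∀ X : Matrix n n ℂ, (K.groundStateFunctional (Xᴴ * R * R * X)).re ≤
      (K.groundStateFunctional (Xᴴ * R * X)).re / γ)
    (h4 : ∀ B : Matrix n n ℂ, B.IsHermitian → 2 * ‖B‖ < γ →
      K.groundEnergy - (K.groundStateFunctional B).re -
            γ / (γ - 2 * ‖B‖) * (K.groundStateFunctional (B * R * B)).re ≤ (K - B).groundEnergy ∧
        (K - B).groundEnergy ≤ K.groundEnergy -
          ((K.groundStateFunctional B).re + (K.groundStateFunctional (B * R * B)).re -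
              ‖B‖ * (K.groundStateFunctional (B * R * R * B)).re) /
            (1 + (K.groundStateFunctional (B * R * R * B)).re))
    (τ : ℝ) {l : ℝ} (hl : 0 < l) (hsmall : 4 * (|τ| * ‖Y‖ + l * ‖O‖) < γ) :
    l * (((K - (τ : ℂ) • Y).groundStateFunctional O).re - (K.groundStateFunctional O).re) ≤
      l * (2 * τ * (K.groundStateFunctional (Y * R * O)).re) +
        l ^ 2 * (K.groundStateFunctional (O * R * O)).re +
        |τ| ^ 2 * (K.groundStateFunctional (Y * R * Y)).re / γ *
          (2 * (|τ| * ‖Y‖) + |τ| ^ 2 * (K.groundStateFunctional (Y * R * Y)).re) +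
        4 * (|τ| * ‖Y‖ + l * ‖O‖) ^ 3 / γ ^ 2 := by
  have hQY0 : 0 ≤ (K.groundStateFunctional (Y * R * Y)).re := by simpa only [hY.eq] using h1 Y
  -- the two Hermitian perturbations `τY` and `B = τY + lO` and their norms
  have hB₁ : ((τ : ℂ) • Y).IsHermitian := isHermitian_real_smul hY τ
  obtain ⟨B, hBdef⟩ : ∃ B : Matrix n n ℂ, B = (τ : ℂ) • Y + (l : ℂ) • O := ⟨_, rfl⟩
  have hB : B.IsHermitian := hBdef ▸ hB₁.add (isHermitian_real_smul hO l)
  have hN₁ : ‖(τ : ℂ) • Y‖ = |τ| * ‖Y‖ := by rw [norm_smul, Complex.norm_real, Real.norm_eq_abs]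
  have hN₂ : ‖B‖ ≤ |τ| * ‖Y‖ + l * ‖O‖ := by
    rw [hBdef]
    refine (norm_add_le _ _).trans (le_of_eq ?_)
    rw [hN₁, norm_smul, Complex.norm_real, Real.norm_eq_abs, abs_of_pos hl]
  have hτY : 0 ≤ |τ| * ‖Y‖ := mul_nonneg (abs_nonneg τ) (norm_nonneg Y)
  have hlO : 0 ≤ l * ‖O‖ := mul_nonneg hl.le (norm_nonneg O)
  have hL0 : 0 ≤ |τ| * ‖Y‖ + l * ‖O‖ := add_nonneg hτY hlO
  have h2B₁ : 2 * ‖(τ : ℂ) • Y‖ < γ := by rw [hN₁]; linarith only [hsmall, hτY, hlO]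
  have h2B₂ : 2 * ‖B‖ < γ := by linarith only [hsmall, hN₂, norm_nonneg B, hL0]
  have h4B₂ : 4 * ‖B‖ ≤ γ := by linarith only [hsmall, hN₂]
  -- the supergradient sandwich at `A = K - τY`
  have hs := sub_mul_re_groundStateFunctional_le (isHermitian_sub_real_smul hK hY τ) hO 0 l
  have hAB : K - (τ : ℂ) • Y - (l : ℂ) • O = K - B := by rw [hBdef, sub_sub]
  simp only [Complex.ofReal_zero, zero_smul, sub_zero] at hs
  rw [hAB] at hs
  obtain ⟨-, hup⟩ := h4 _ hB₁ h2B₁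
  obtain ⟨hlow, -⟩ := h4 _ hB h2B₂
  have hρ₁ : 0 ≤ (K.groundStateFunctional ((τ : ℂ) • Y * R * R * ((τ : ℂ) • Y))).re := by
    have h := groundStateFunctional_nonneg K (R * ((τ : ℂ) • Y))
    have e : (R * ((τ : ℂ) • Y))ᴴ * (R * ((τ : ℂ) • Y)) = (τ : ℂ) • Y * R * R * ((τ : ℂ) • Y) := by
      rw [conjTranspose_mul, hR.eq, hB₁.eq, ← Matrix.mul_assoc]
    rw [e] at h
    exact (Complex.nonneg_iff.mp h).1
  have hρQ := h3 ((τ : ℂ) • Y)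
  rw [hB₁.eq] at hρQ
  have hQ₁pos := h1 ((τ : ℂ) • Y)
  rw [hB₁.eq] at hQ₁pos
  have hQ₂pos := h1 B
  rw [hB.eq] at hQ₂pos
  have hQ₂le : (K.groundStateFunctional (B * R * B)).re ≤ ‖B‖ ^ 2 / γ := by
    have h := h2 B
    rw [hB.eq] at h
    refine h.trans (div_le_div_of_nonneg_right ?_ hγ.le)
    have hb : (K.groundStateFunctional (B * B)).re ≤ ‖B‖ ^ 2 :=
      calc (K.groundStateFunctional (B * B)).re ≤ |(K.groundStateFunctional (B * B)).re| :=
            le_abs_self _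
        _ ≤ ‖B * B‖ := abs_re_groundStateFunctional_le_norm hK _
        _ ≤ ‖B‖ * ‖B‖ := norm_mul_le _ _
        _ = ‖B‖ ^ 2 := (sq _).symm
    linarith only [hb, sq_nonneg ‖K.groundStateFunctional B‖]
  -- expansions of the first- and second-order terms
  have hw₁ : (K.groundStateFunctional ((τ : ℂ) • Y)).re = τ * (K.groundStateFunctional Y).re := by
    rw [map_smul, smul_eq_mul, Complex.re_ofReal_mul]
  have hw₂ : (K.groundStateFunctional B).re =
      τ * (K.groundStateFunctional Y).re + l * (K.groundStateFunctional O).re := by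
    rw [hBdef, map_add, Complex.add_re, map_smul, map_smul, smul_eq_mul, smul_eq_mul,
      Complex.re_ofReal_mul, Complex.re_ofReal_mul]
  have hQ₁ : (K.groundStateFunctional ((τ : ℂ) • Y * R * ((τ : ℂ) • Y))).re =
      |τ| ^ 2 * (K.groundStateFunctional (Y * R * Y)).re := by
    rw [re_smul_quad, sq_abs]
  have hQ₂ : (K.groundStateFunctional (B * R * B)).re =
      |τ| ^ 2 * (K.groundStateFunctional (Y * R * Y)).re +
        τ * l * (2 * (K.groundStateFunctional (Y * R * O)).re) +
        l ^ 2 * (K.groundStateFunctional (O * R * O)).re := by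
    rw [hBdef, re_quad_expand, re_gsf_rev hY hO hR, sq_abs]
    ring
  have hup' := upper_aux hρ₁ hQ₁pos (abs_re_groundStateFunctional_le_norm hK _) hup
  have hlow' := lower_aux hγ hQ₂pos (norm_nonneg _) h4B₂ hlow
  rw [hN₁, hQ₁] at hup'
  rw [hQ₁] at hρQ
  -- error-term bounds
  have hρb : (K.groundStateFunctional ((τ : ℂ) • Y * R * R * ((τ : ℂ) • Y))).re *
      (2 * (|τ| * ‖Y‖) + |τ| ^ 2 * (K.groundStateFunctional (Y * R * Y)).re) ≤
        |τ| ^ 2 * (K.groundStateFunctional (Y * R * Y)).re / γ *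
          (2 * (|τ| * ‖Y‖) + |τ| ^ 2 * (K.groundStateFunctional (Y * R * Y)).re) :=
    mul_le_mul_of_nonneg_right hρQ
      (add_nonneg (mul_nonneg zero_le_two hτY) (mul_nonneg (sq_nonneg _) hQY0))
  have hNb : 4 * ‖B‖ * (K.groundStateFunctional (B * R * B)).re / γ ≤
      4 * (|τ| * ‖Y‖ + l * ‖O‖) ^ 3 / γ ^ 2 :=
    calc 4 * ‖B‖ * (K.groundStateFunctional (B * R * B)).re / γ
        = 4 / γ * (‖B‖ * (K.groundStateFunctional (B * R * B)).re) := by ring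
      _ ≤ 4 / γ * ((|τ| * ‖Y‖ + l * ‖O‖) * (‖B‖ ^ 2 / γ)) :=
          mul_le_mul_of_nonneg_left (mul_le_mul hN₂ hQ₂le hQ₂pos hL0)
            (div_nonneg zero_le_four hγ.le)
      _ ≤ 4 / γ * ((|τ| * ‖Y‖ + l * ‖O‖) * ((|τ| * ‖Y‖ + l * ‖O‖) ^ 2 / γ)) :=
          mul_le_mul_of_nonneg_left (mul_le_mul_of_nonneg_left (div_le_div_of_nonneg_right
            (pow_le_pow_left₀ (norm_nonneg B) hN₂ 2) hγ.le) hL0) (div_nonneg zero_le_four hγ.le)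
      _ = 4 * (|τ| * ‖Y‖ + l * ‖O‖) ^ 3 / γ ^ 2 := by ring
  linarith only [hs, hup', hlow', hw₁, hw₂, hQ₂, hρb, hNb]

/-- **One-sided slope estimate.** Granted the reduced-resolvent clauses at `(K, γ)`, for every
`ε > 0` there is `τ₀ > 0` with `Re ω_{K-τY}(O) - Re ω_K(O) ≤ (2√(Var O · Var Y)/γ + ε)|τ|` for
`|τ| < τ₀` (the core inequality with `l = κ|τ|`, `κ = ε/(2Q_O + 1)`, Cauchy–Schwarz
`γ|Re ω(YRO)| ≤ √(Var O · Var Y)`, all error terms `O(|τ|²)`). [folklore] -/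
theorem slope_le [Nonempty n] {K O Y R : Matrix n n ℂ} (hK : K.IsHermitian) (hO : O.IsHermitian)
    (hY : Y.IsHermitian) (hR : R.IsHermitian) {γ : ℝ} (hγ : 0 < γ)
    (h1 : ∀ X : Matrix n n ℂ, 0 ≤ (K.groundStateFunctional (Xᴴ * R * X)).re)
    (h2 : ∀ X : Matrix n n ℂ, (K.groundStateFunctional (Xᴴ * R * X)).re ≤
      ((K.groundStateFunctional (Xᴴ * X)).re - ‖K.groundStateFunctional X‖ ^ 2) / γ)
    (h3 : ∀ X : Matrix n n ℂ, (K.groundStateFunctional (Xᴴ * R * R * X)).re ≤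
      (K.groundStateFunctional (Xᴴ * R * X)).re / γ)
    (h4 : ∀ B : Matrix n n ℂ, B.IsHermitian → 2 * ‖B‖ < γ →
      K.groundEnergy - (K.groundStateFunctional B).re -
            γ / (γ - 2 * ‖B‖) * (K.groundStateFunctional (B * R * B)).re ≤ (K - B).groundEnergy ∧
        (K - B).groundEnergy ≤ K.groundEnergy -
          ((K.groundStateFunctional B).re + (K.groundStateFunctional (B * R * B)).re -
              ‖B‖ * (K.groundStateFunctional (B * R * R * B)).re) /
            (1 + (K.groundStateFunctional (B * R * R * B)).re))
    {ε : ℝ} (hε : 0 < ε) :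
    ∃ τ₀ : ℝ, 0 < τ₀ ∧ ∀ τ : ℝ, |τ| < τ₀ →
      ((K - (τ : ℂ) • Y).groundStateFunctional O).re - (K.groundStateFunctional O).re ≤
        (2 * Real.sqrt (((K.groundStateFunctional (O * O)).re -
              (K.groundStateFunctional O).re ^ 2) *
            ((K.groundStateFunctional (Y * Y)).re - (K.groundStateFunctional Y).re ^ 2)) / γ + ε) *
          |τ| := by
  -- abbreviate `S = √(Var O · Var Y)`; `Q_O, Q_Y ≥ 0`, the variance bounds, Cauchy–Schwarz
  obtain ⟨S, hS⟩ : ∃ S : ℝ, S = Real.sqrt (((K.groundStateFunctional (O * O)).re -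
      (K.groundStateFunctional O).re ^ 2) *
        ((K.groundStateFunctional (Y * Y)).re - (K.groundStateFunctional Y).re ^ 2)) := ⟨_, rfl⟩
  rw [← hS]
  have hQO0 : 0 ≤ (K.groundStateFunctional (O * R * O)).re := by simpa only [hO.eq] using h1 O
  have hQY0 : 0 ≤ (K.groundStateFunctional (Y * R * Y)).re := by simpa only [hY.eq] using h1 Y
  have hvar : ∀ X : Matrix n n ℂ, X.IsHermitian →
      γ * (K.groundStateFunctional (X * R * X)).re ≤
        (K.groundStateFunctional (X * X)).re - (K.groundStateFunctional X).re ^ 2 := by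
    intro X hX
    have h := h2 X
    rw [hX.eq, le_div_iff₀ hγ] at h
    have hre := abs_le.mp (Complex.abs_re_le_norm (K.groundStateFunctional X))
    have hsq := sq_le_sq' hre.1 hre.2
    linarith only [h, hsq]
  have hVO := hvar O hO
  have hVY := hvar Y hY
  have hVO0 : 0 ≤ (K.groundStateFunctional (O * O)).re - (K.groundStateFunctional O).re ^ 2 :=
    (mul_nonneg hγ.le hQO0).trans hVO
  have hcs := re_cross_sq_le hO hY hR h1
  have hcS : |(K.groundStateFunctional (Y * R * O)).re| * γ ≤ S := by
    rw [← abs_of_pos hγ, ← abs_mul, hS]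
    apply Real.abs_le_sqrt
    calc ((K.groundStateFunctional (Y * R * O)).re * γ) ^ 2
        = γ ^ 2 * (K.groundStateFunctional (Y * R * O)).re ^ 2 := by ring
      _ ≤ γ ^ 2 * ((K.groundStateFunctional (Y * R * Y)).re *
            (K.groundStateFunctional (O * R * O)).re) :=
          mul_le_mul_of_nonneg_left hcs (sq_nonneg γ)
      _ = γ * (K.groundStateFunctional (O * R * O)).re *
            (γ * (K.groundStateFunctional (Y * R * Y)).re) := by ring
      _ ≤ _ := mul_le_mul hVO hVY (mul_nonneg hγ.le hQY0) hVO0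
  -- the constants `κ`, `C` and `τ₀`
  obtain ⟨κ, hκdef⟩ : ∃ κ : ℝ, κ = ε / (2 * (K.groundStateFunctional (O * R * O)).re + 1) :=
    ⟨_, rfl⟩
  have h2Q : 0 < 2 * (K.groundStateFunctional (O * R * O)).re + 1 := by linarith only [hQO0]
  have hκ : 0 < κ := hκdef ▸ div_pos hε h2Q
  have hκQ : κ * (K.groundStateFunctional (O * R * O)).re ≤ ε / 2 := by
    rw [hκdef, div_mul_eq_mul_div, div_le_iff₀ h2Q]
    linarith only [hε]
  have hL0 : 0 ≤ ‖Y‖ + κ * ‖O‖ := add_nonneg (norm_nonneg Y) (mul_nonneg hκ.le (norm_nonneg O))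
  obtain ⟨C, hC⟩ : ∃ C : ℝ, C = (K.groundStateFunctional (Y * R * Y)).re / γ *
      (2 * ‖Y‖ + (K.groundStateFunctional (Y * R * Y)).re) + 4 * (‖Y‖ + κ * ‖O‖) ^ 3 / γ ^ 2 :=
    ⟨_, rfl⟩
  have hC0 : 0 ≤ C := by
    rw [hC]
    exact add_nonneg (mul_nonneg (div_nonneg hQY0 hγ.le)
      (by linarith only [norm_nonneg Y, hQY0])) (div_nonneg (mul_nonneg zero_le_four
        (pow_nonneg hL0 3)) (sq_nonneg γ))
  have hL1 : 0 < 4 * (‖Y‖ + κ * ‖O‖) + 1 := by linarith only [hL0]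
  have hC1 : 0 < 2 * C + 1 := by linarith only [hC0]
  refine ⟨min 1 (min (γ / (4 * (‖Y‖ + κ * ‖O‖) + 1)) (ε * κ / (2 * C + 1))),
    lt_min one_pos (lt_min (div_pos hγ hL1) (div_pos (mul_pos hε hκ) hC1)), fun τ hτ => ?_⟩
  have hτ1 : |τ| < 1 := lt_of_lt_of_le hτ (min_le_left _ _)
  have hτL : |τ| < γ / (4 * (‖Y‖ + κ * ‖O‖) + 1) :=
    lt_of_lt_of_le hτ ((min_le_right _ _).trans (min_le_left _ _))
  have hτC : |τ| < ε * κ / (2 * C + 1) :=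
    lt_of_lt_of_le hτ ((min_le_right _ _).trans (min_le_right _ _))
  rcases eq_or_ne τ 0 with rfl | hτ0
  · simp only [Complex.ofReal_zero, zero_smul, sub_zero, sub_self, abs_zero, mul_zero, le_refl]
  have ha : 0 < |τ| := abs_pos.mpr hτ0
  have hl : 0 < κ * |τ| := mul_pos hκ ha
  have hsmall : 4 * (|τ| * ‖Y‖ + κ * |τ| * ‖O‖) < γ := by
    rw [lt_div_iff₀ hL1] at hτL
    linarith only [hτL, ha]
  have hcore := core hK hO hY hR hγ h1 h2 h3 h4 τ hl hsmall
  have hc₂ : 2 * τ * (K.groundStateFunctional (Y * R * O)).re ≤ 2 * S / γ * |τ| := by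
    have e1 : τ * (K.groundStateFunctional (Y * R * O)).re ≤
        |τ| * |(K.groundStateFunctional (Y * R * O)).re| := by
      rw [← abs_mul]
      exact le_abs_self _
    have hcle : |(K.groundStateFunctional (Y * R * O)).re| ≤ S / γ := by
      rw [le_div_iff₀ hγ]
      exact hcS
    have e2 := mul_le_mul_of_nonneg_left hcle (abs_nonneg τ)
    rw [show 2 * S / γ * |τ| = 2 * (|τ| * (S / γ)) by ring]
    linarith only [e1, e2]
  have haC : |τ| * C ≤ ε * κ / 2 := by
    rw [lt_div_iff₀ hC1] at hτC
    linarith only [hτC, ha]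
  exact final_aux ha hτ1.le hκ hγ hQY0 hcore hc₂ hκQ hC haC

end CwSlope

open CwSlope in
/-- **Stub `stub_slopeOfEnergyBounds`** (the local Hellmann–Feynman slope from the energy bounds).
Granted the two-sided second-order energy bounds (hypothesis, verbatim the statement of
`stub_secondOrderEnergyBounds`): for Hermitian `K, O, Y` with `K.HasSpectralGap γ` and every `ε > 0`,
for all small real `τ`, `|Re ω_{K-τY}(O) - Re ω_K(O)| ≤ (2√(Var_K O · Var_K Y)/γ + ε)|τ|`
(`CwSlope.slope_le` for `O` and for `-O`). [folklore] -/
theorem stub_slopeOfEnergyBounds :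
    (∀ {n : Type} [Fintype n] [DecidableEq n] [Nonempty n] (K : Matrix n n ℂ) (g : ℝ), K.IsHermitian → 0 < g → K.HasSpectralGap g → ∃ R : Matrix n n ℂ, R.IsHermitian ∧ (∀ X : Matrix n n ℂ, 0 ≤ (K.groundStateFunctional (Xᴴ * R * X)).re) ∧ (∀ X : Matrix n n ℂ, (K.groundStateFunctional (Xᴴ * R * X)).re ≤ ((K.groundStateFunctional (Xᴴ * X)).re - ‖K.groundStateFunctional X‖ ^ 2) / g) ∧ (∀ X : Matrix n n ℂ, (K.groundStateFunctional (Xᴴ * R * R * X)).re ≤ (K.groundStateFunctional (Xᴴ * R * X)).re / g) ∧ ∀ B : Matrix n n ℂ, B.IsHermitian → 2 * ‖B‖ < g → K.groundEnergy - (K.groundStateFunctional B).re - g / (g - 2 * ‖B‖) * (K.groundStateFunctional (B * R * B)).re ≤ (K - B).groundEnergy ∧ (K - B).groundEnergy ≤ K.groundEnergy - ((K.groundStateFunctional B).re + (K.groundStateFunctional (B * R * B)).re - ‖B‖ * (K.groundStateFunctional (B * R * R * B)).re) / (1 + (K.groundStateFunctional (B * R * R * B)).re)) →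
    ∀ {n : Type} [Fintype n] [DecidableEq n] [Nonempty n] (K O Y : Matrix n n ℂ), K.IsHermitian → O.IsHermitian → Y.IsHermitian → ∀ (γ : ℝ), 0 < γ → K.HasSpectralGap γ → ∀ ε : ℝ, 0 < ε → ∃ τ₀ : ℝ, 0 < τ₀ ∧ ∀ τ : ℝ, |τ| < τ₀ → |((K - (τ : ℂ) • Y).groundStateFunctional O).re - (K.groundStateFunctional O).re| ≤ (2 * Real.sqrt ((((K.groundStateFunctional (O * O)).re - (K.groundStateFunctional O).re ^ 2)) * ((K.groundStateFunctional (Y * Y)).re - (K.groundStateFunctional Y).re ^ 2)) / γ + ε) * |τ| := by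
  intro hA n _ _ _ K O Y hK hO hY γ hγ hgap ε hε
  obtain ⟨R, hR, h1, h2, h3, h4⟩ := hA K γ hK hγ hgap
  obtain ⟨τ₁, hτ₁, hle₁⟩ := slope_le hK hO hY hR hγ h1 h2 h3 h4 hε
  obtain ⟨τ₂, hτ₂, hle₂⟩ := slope_le hK hO.neg hY hR hγ h1 h2 h3 h4 hε
  refine ⟨min τ₁ τ₂, lt_min hτ₁ hτ₂, fun τ hτ => ?_⟩
  have hup := hle₁ τ (lt_of_lt_of_le hτ (min_le_left _ _))
  have hlo := hle₂ τ (lt_of_lt_of_le hτ (min_le_right _ _))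
  simp only [map_neg, Complex.neg_re, neg_mul_neg, neg_sq] at hlo
  rw [abs_le]
  constructor <;> linarith only [hup, hlo]


end Summit.HubbardSuperconductivity.HubbardSuperconductivity.Theorems
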